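import Summits.MatrixMultiplication.MatrixMultiplication.Theorems.SaturationLadderTowerLimit
import Summits.MatrixMultiplication.MatrixMultiplication.Theorems.SaturationLadderGaugeConeClasses
import HarnessLib

/-!
# Saturation ladder — Kernel XXIII: the thin frontier `τ_ℂ(r)` as the single dial of piece 1

Cell `decomp-mm`, lens `decomp-mm-lens-1` (grading / quantitative ladder), gen 51; supports the
deciding crux `SubexpSaturation` (item 25909) of `route-MatrixMultiplication-SaturationLadder`.
No new hypotheses, no `sorry`.

Kernel XXII (`SaturationLadderTowerLimit`) proved that for every `r ≥ 0` the thin frontier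
`τ_K(r) := sSup {t | ω_K(1,t,r) ≤ 1 + r}` is ATTAINED and is the exact threshold:
`ω_K(1,t,r) ≤ 1 + r ↔ t ≤ τ_K(r)`, `0 ≤ τ_K(r) ≤ 1`, `τ_K` monotone. This kernel rewrites the whole
quantitative status of piece 1 in terms of the ONE real function `r ↦ τ_ℂ(r)` and its
**frontier defect** `Δ(r) := (1 − τ_ℂ(r))·log r ≥ 0`:

* §2 (change of variable `r = e^{c/(1−t)} ⟺ t = 1 − c/log r`): for every `c > 0`, the rate clause
  of `SubexpSaturation` at `c` holds iff `τ_ℂ(r) ≥ 1 − c/log r` for all large `r`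
  (`clause_iff_frontier`); hence
  `SubexpSaturation ↔ ∀ c > 0, eventually τ_ℂ(r) ≥ 1 − c/log r ↔ ∀ c > 0, eventually Δ(r) ≤ c
   ↔ Δ(r) → 0 (r → ∞)` (`subexpSaturation_iff_frontier`, `_iff_frontierDefect`, `_iff_tendsto`).
* §3 THE TREE'S RUNG in this currency: `limsup Δ ≤ c₂ = (5 log(5/4) + 3 log 2)/3 = 1.0650…` —
  for every `c > c₂`, eventually `τ_ℂ(r) ≥ 1 − c/log r` and `Δ(r) ≤ c` (from the lineage's
  `clause_above_classCeiling`); unconditionally `τ_ℂ(r) → 1` (from `expSaturation_holds`) and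
  `α₀ ≤ τ_ℂ(1)` (Coppersmith).  So piece 1 is EXACTLY the statement that the eventual range of `Δ`
  shrinks from the certified `[0, 1.0650…]` to `{0}`.
* §4 THE SUMMIT in this currency: `ω = 2 ↔ τ_ℂ(1) = 1 ↔ τ_ℂ ≡ 1 on [1, ∞)` (so under the summit
  `Δ ≡ 0`; piece 1 asks only `Δ → 0`, which is why it is tagged WEAKER).

[novel: the items of this file are bookkeeping over Kernel XXII and the lineage's rate theorems;
the change of variable and the squeeze are folklore.]
-/

set_option linter.dupNamespace false

namespace Summit.MatrixMultiplication.MatrixMultiplication.Theorems.SaturationLadderFrontierDefect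

open Literature.Computability.AlgebraicComplexity
open Summit.MatrixMultiplication.OmegaCensus
open Summit.MatrixMultiplication.MatrixMultiplication.Theses.SaturationLadder
open Summit.MatrixMultiplication.MatrixMultiplication.Theorems.SaturationLadderTowerLimit
open Summit.MatrixMultiplication.MatrixMultiplication.Theorems.SaturationLadderGaugeConeClasses
open Summit.MatrixMultiplication.MatrixMultiplication.Theorems.SaturationLadderExpSaturation
open Filter Topology

noncomputable section

/-! ## §1 The frontier `τ_ℂ(r) = sSup {t | ω(1,t,r) ≤ 1 + r}` (recalled from Kernel XXII) -/

/-- Threshold property: for `r ≥ 0`, `ω_ℂ(1,t,r) ≤ 1 + r ↔ t ≤ τ_ℂ(r)`. [del: Kernel XXII] -/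
theorem tight_iff_le_frontier {r : ℝ} (hr : 0 ≤ r) (t : ℝ) :
    omegaRect ℂ 1 t r ≤ 1 + r ↔ t ≤ sSup {t : ℝ | omegaRect ℂ 1 t r ≤ 1 + r} :=
  (thinFrontier_attained ℂ hr).2.2.2 t

/-- `τ_ℂ(r) ≤ 1` for `r ≥ 0`. [del: Kernel XXII] -/
theorem frontier_le_one {r : ℝ} (hr : 0 ≤ r) :
    sSup {t : ℝ | omegaRect ℂ 1 t r ≤ 1 + r} ≤ 1 :=
  (thinFrontier_attained ℂ hr).2.2.1

/-- `0 ≤ τ_ℂ(r)` for `r ≥ 0`. [del: Kernel XXII] -/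
theorem frontier_nonneg {r : ℝ} (hr : 0 ≤ r) :
    0 ≤ sSup {t : ℝ | omegaRect ℂ 1 t r ≤ 1 + r} :=
  (thinFrontier_attained ℂ hr).2.1

/-- The frontier defect `Δ(r) = (1 − τ_ℂ(r))·log r` is `≥ 0` on `[1, ∞)`. [folklore] -/
theorem frontierDefect_nonneg {r : ℝ} (hr : 1 ≤ r) :
    0 ≤ (1 - sSup {t : ℝ | omegaRect ℂ 1 t r ≤ 1 + r}) * Real.log r :=
  mul_nonneg (sub_nonneg.2 (frontier_le_one (by linarith))) (Real.log_nonneg hr)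

/-! ## §2 The rate clause of piece 1 ⟺ an eventual lower bound on the frontier -/

/-- **Change of variable.**  For `c > 0`: the rate clause of `SubexpSaturation` at `c`
(`∃ t₀ < 1, ∀ t ∈ [t₀,1), ∃ r ∈ [1, e^{c/(1−t)}]` tight at `(1,t,r)`) holds iff
`τ_ℂ(r) ≥ 1 − c/log r` for all sufficiently large `r`.  (`r = e^{c/(1−t)} ⟺ t = 1 − c/log r`;
tightness is up-closed in `r` and `τ_ℂ(r)` is the exact threshold in `t`.) [folklore] -/
theorem clause_iff_frontier {c : ℝ} (hc : 0 < c) :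
    (∃ t₀ : ℝ, t₀ < 1 ∧ ∀ t : ℝ, t₀ ≤ t → t < 1 →
        ∃ r : ℝ, 1 ≤ r ∧ r ≤ Real.exp (c / (1 - t)) ∧ omegaRect ℂ 1 t r ≤ 1 + r) ↔
    ∃ r₀ : ℝ, ∀ r : ℝ, r₀ ≤ r →
      1 - c / Real.log r ≤ sSup {t : ℝ | omegaRect ℂ 1 t r ≤ 1 + r} := by
  constructor
  · rintro ⟨t₀, ht₀, h⟩
    refine ⟨Real.exp (c / (1 - t₀)), fun r hr => ?_⟩
    have h1t₀ : 0 < 1 - t₀ := by linarith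
    have hexp_gt : 1 < Real.exp (c / (1 - t₀)) := by
      have h0 : (0 : ℝ) < c / (1 - t₀) := div_pos hc h1t₀
      have := Real.add_one_le_exp (c / (1 - t₀))
      linarith
    have hr1 : 1 < r := hexp_gt.trans_le hr
    have hlog : 0 < Real.log r := Real.log_pos hr1
    set t : ℝ := 1 - c / Real.log r with ht
    have hct : 0 < c / Real.log r := div_pos hc hlog
    have ht1 : t < 1 := by rw [ht]; linarith
    have hlr : c / (1 - t₀) ≤ Real.log r := by
      have := Real.log_le_log (Real.exp_pos _) hr
      rwa [Real.log_exp] at this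
    have htt₀ : t₀ ≤ t := by
      have h' : c ≤ Real.log r * (1 - t₀) := (div_le_iff₀ h1t₀).1 hlr
      have : c / Real.log r ≤ 1 - t₀ := by
        rw [div_le_iff₀ hlog]; linarith
      rw [ht]; linarith
    obtain ⟨r', -, hr'le, htight⟩ := h t htt₀ ht1
    have h1t : 1 - t = c / Real.log r := by rw [ht]; ring
    have hexp : Real.exp (c / (1 - t)) = r := by
      rw [h1t, div_div_cancel₀ hc.ne']  -- `c / (c / log r) = log r`
      exact Real.exp_log (by linarith)
    have hr'r : r' ≤ r := hexp ▸ hr'le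
    have htight_r : omegaRect ℂ 1 t r ≤ 1 + r := thinTight_of_len_le ℂ hr'r htight
    exact (tight_iff_le_frontier (by linarith) t).1 htight_r
  · rintro ⟨r₀, h⟩
    set R : ℝ := max r₀ 2 with hR
    have hR2 : 2 ≤ R := le_max_right _ _
    have hlogR : 0 < Real.log R := Real.log_pos (by linarith)
    have hcR : 0 < c / Real.log R := div_pos hc hlogR
    refine ⟨1 - c / Real.log R, by linarith, fun t ht ht1 => ?_⟩
    set r : ℝ := Real.exp (c / (1 - t)) with hr
    have h1t : 0 < 1 - t := by linarith
    have hlogr : Real.log r = c / (1 - t) := by rw [hr, Real.log_exp]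
    have hrR : R ≤ r := by
      have h1 : 1 - t ≤ c / Real.log R := by linarith
      have h1' : (1 - t) * Real.log R ≤ c := (le_div_iff₀ hlogR).1 h1
      have h2 : Real.log R ≤ c / (1 - t) := by
        rw [le_div_iff₀ h1t]; linarith
      calc R = Real.exp (Real.log R) := (Real.exp_log (by linarith)).symm
        _ ≤ r := by rw [hr]; exact Real.exp_le_exp.2 h2
    have hτ := h r ((le_max_left _ _).trans hrR)
    have hsub : 1 - c / Real.log r = t := by
      rw [hlogr, div_div_cancel₀ hc.ne']; ring
    rw [hsub] at hτ
    have hr1 : 1 ≤ r := by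
      have := Real.add_one_le_exp (c / (1 - t))
      have h0 : 0 ≤ c / (1 - t) := (div_pos hc h1t).le
      rw [hr]; linarith
    exact ⟨r, hr1, le_rfl, (tight_iff_le_frontier (by linarith) t).2 hτ⟩

/-- For `c > 0`: an eventual frontier bound `τ_ℂ(r) ≥ 1 − c/log r` is the same as an eventual
defect bound `Δ(r) = (1 − τ_ℂ(r))·log r ≤ c`. [folklore] -/
theorem frontier_iff_defect {c : ℝ} :
    (∃ r₀ : ℝ, ∀ r : ℝ, r₀ ≤ r →
        1 - c / Real.log r ≤ sSup {t : ℝ | omegaRect ℂ 1 t r ≤ 1 + r}) ↔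
    ∃ r₀ : ℝ, ∀ r : ℝ, r₀ ≤ r →
      (1 - sSup {t : ℝ | omegaRect ℂ 1 t r ≤ 1 + r}) * Real.log r ≤ c := by
  constructor
  · rintro ⟨r₀, h⟩
    refine ⟨max r₀ 2, fun r hr => ?_⟩
    have hr2 : 2 ≤ r := (le_max_right _ _).trans hr
    have hlog : 0 < Real.log r := Real.log_pos (by linarith)
    have h1 := h r ((le_max_left _ _).trans hr)
    have h2 : 1 - sSup {t : ℝ | omegaRect ℂ 1 t r ≤ 1 + r} ≤ c / Real.log r := by linarith
    calc (1 - sSup {t : ℝ | omegaRect ℂ 1 t r ≤ 1 + r}) * Real.log r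
        ≤ c / Real.log r * Real.log r := mul_le_mul_of_nonneg_right h2 hlog.le
      _ = c := div_mul_cancel₀ c hlog.ne'
  · rintro ⟨r₀, h⟩
    refine ⟨max r₀ 2, fun r hr => ?_⟩
    have hr2 : 2 ≤ r := (le_max_right _ _).trans hr
    have hlog : 0 < Real.log r := Real.log_pos (by linarith)
    have h1 := h r ((le_max_left _ _).trans hr)
    have h2 : 1 - sSup {t : ℝ | omegaRect ℂ 1 t r ≤ 1 + r} ≤ c / Real.log r := by
      rw [le_div_iff₀ hlog]; exact h1
    linarith

/-- **Piece 1 as a frontier statement**: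
`SubexpSaturation ↔ ∀ c > 0, ∃ r₀, ∀ r ≥ r₀, τ_ℂ(r) ≥ 1 − c/log r`. [folklore] -/
theorem subexpSaturation_iff_frontier :
    SubexpSaturation ↔ ∀ c : ℝ, 0 < c → ∃ r₀ : ℝ, ∀ r : ℝ, r₀ ≤ r →
      1 - c / Real.log r ≤ sSup {t : ℝ | omegaRect ℂ 1 t r ≤ 1 + r} :=
  forall₂_congr fun _ hc => clause_iff_frontier hc

/-- **Piece 1 as a defect statement**:
`SubexpSaturation ↔ ∀ c > 0, ∃ r₀, ∀ r ≥ r₀, (1 − τ_ℂ(r))·log r ≤ c`. [folklore] -/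
theorem subexpSaturation_iff_frontierDefect :
    SubexpSaturation ↔ ∀ c : ℝ, 0 < c → ∃ r₀ : ℝ, ∀ r : ℝ, r₀ ≤ r →
      (1 - sSup {t : ℝ | omegaRect ℂ 1 t r ≤ 1 + r}) * Real.log r ≤ c := by
  rw [subexpSaturation_iff_frontier]
  exact forall₂_congr fun _ _ => frontier_iff_defect

/-- **Piece 1 as a limit**: `SubexpSaturation ↔ Δ(r) = (1 − τ_ℂ(r))·log r → 0` as `r → ∞`
(squeeze with `Δ ≥ 0` on `[1,∞)`). [folklore] -/
theorem subexpSaturation_iff_tendsto :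
    SubexpSaturation ↔
      Tendsto (fun r : ℝ => (1 - sSup {t : ℝ | omegaRect ℂ 1 t r ≤ 1 + r}) * Real.log r)
        atTop (𝓝 0) := by
  rw [subexpSaturation_iff_frontierDefect, Metric.tendsto_atTop]
  constructor
  · intro h ε hε
    obtain ⟨r₀, hr₀⟩ := h (ε / 2) (by linarith)
    refine ⟨max r₀ 1, fun r hr => ?_⟩
    have hr1 : 1 ≤ r := (le_max_right _ _).trans hr
    have hle := hr₀ r ((le_max_left _ _).trans hr)
    rw [Real.dist_eq, sub_zero, abs_of_nonneg (frontierDefect_nonneg hr1)]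
    linarith
  · intro h c hc
    obtain ⟨N, hN⟩ := h c hc
    refine ⟨N, fun r hr => ?_⟩
    have := hN r hr
    rw [Real.dist_eq, sub_zero] at this
    exact (abs_lt.1 this).2.le

/-! ## §3 The tree's rung in this currency: `limsup Δ ≤ c₂ = (5 log(5/4) + 3 log 2)/3` -/

/-- **Frontier lower bound above the class ceiling** (the lineage's proved rate clause
`clause_above_classCeiling`, transported): for every `c > c₂ = (5 log(5/4) + 3 log 2)/3 = 1.0650…`
there is `r₀` with `τ_ℂ(r) ≥ 1 − c/log r` for all `r ≥ r₀`. [del: clause_above_classCeiling] -/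
theorem frontier_lower_eventually (c : ℝ) (hc : (5 * Real.log (5 / 4) + 3 * Real.log 2) / 3 < c) :
    ∃ r₀ : ℝ, ∀ r : ℝ, r₀ ≤ r →
      1 - c / Real.log r ≤ sSup {t : ℝ | omegaRect ℂ 1 t r ≤ 1 + r} :=
  (clause_iff_frontier (classCeiling_pos.trans hc)).1 (clause_above_classCeiling c hc)

/-- **Defect bound above the class ceiling**: for every `c > c₂`, eventually
`Δ(r) = (1 − τ_ℂ(r))·log r ≤ c`; i.e. `limsup_{r→∞} Δ(r) ≤ c₂ = 1.0650…`, while piece 1 asks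
`lim Δ = 0` (`subexpSaturation_iff_tendsto`). [del: clause_above_classCeiling] -/
theorem frontierDefect_eventually_le (c : ℝ)
    (hc : (5 * Real.log (5 / 4) + 3 * Real.log 2) / 3 < c) :
    ∃ r₀ : ℝ, ∀ r : ℝ, r₀ ≤ r →
      (1 - sSup {t : ℝ | omegaRect ℂ 1 t r ≤ 1 + r}) * Real.log r ≤ c :=
  frontier_iff_defect.1 (frontier_lower_eventually c hc)

/-- The gap of piece 1 in one line: the defect clause holds for every `c > c₂`, and piece 1 is the
same clause for every `c > 0`. [folklore] -/
theorem subexpSaturation_iff_defect_below_classCeiling :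
    SubexpSaturation ↔ ∀ c : ℝ, 0 < c → c ≤ (5 * Real.log (5 / 4) + 3 * Real.log 2) / 3 →
      ∃ r₀ : ℝ, ∀ r : ℝ, r₀ ≤ r →
        (1 - sSup {t : ℝ | omegaRect ℂ 1 t r ≤ 1 + r}) * Real.log r ≤ c := by
  rw [subexpSaturation_iff_frontierDefect]
  refine ⟨fun h c hc _ => h c hc, fun h c hc => ?_⟩
  rcases le_or_gt c ((5 * Real.log (5 / 4) + 3 * Real.log 2) / 3) with hle | hlt
  · exact h c hc hle
  · exact frontierDefect_eventually_le c hlt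

/-- **Unconditionally `τ_ℂ(r) → 1`** (`r → ∞`): from exponential saturation
(`expSaturation_holds`: every `t ∈ [0,1)` is tight at some `r ≤ 16·4^{1/(1−t)}`), up-closure in
`r`, and `τ_ℂ ≤ 1`. [del: expSaturation_holds] -/
theorem tendsto_frontier_one :
    Tendsto (fun r : ℝ => sSup {t : ℝ | omegaRect ℂ 1 t r ≤ 1 + r}) atTop (𝓝 1) := by
  rw [Metric.tendsto_atTop]
  intro ε hε
  set t : ℝ := max 0 (1 - ε / 2) with ht
  have ht0 : 0 ≤ t := le_max_left _ _
  have ht1 : t < 1 := max_lt (by norm_num) (by linarith)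
  have htε : 1 - ε / 2 ≤ t := le_max_right _ _
  obtain ⟨r, hr1, -, htight⟩ := expSaturation_holds t ht0 ht1
  refine ⟨r, fun R hR => ?_⟩
  have hR0 : 0 ≤ R := by linarith
  have htightR : omegaRect ℂ 1 t R ≤ 1 + R := thinTight_of_len_le ℂ hR htight
  have hτ : t ≤ sSup {t : ℝ | omegaRect ℂ 1 t R ≤ 1 + R} := (tight_iff_le_frontier hR0 t).1 htightR
  have hτ1 := frontier_le_one hR0
  rw [Real.dist_eq, abs_sub_comm, abs_of_nonneg (by linarith)]
  linarith

/-- **Coppersmith's point on the frontier**: `α₀ = log 4/(5 log 5) ≤ τ_ℂ(1)` (`ω(1,α₀,1) = 2`).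
[del: coppersmith1982_omegaRect_eq_two] -/
theorem coppersmithExponent_le_frontier_one :
    coppersmithExponent ≤ sSup {t : ℝ | omegaRect ℂ 1 t 1 ≤ 1 + 1} := by
  refine (tight_iff_le_frontier zero_le_one coppersmithExponent).1 ?_
  rw [omegaRect_swap₂₃, coppersmith1982_omegaRect_eq_two]
  norm_num

/-- A squaring-tower point strictly inside `(1/5, 1/4)` on the frontier at `r = log 5/log 2`:
`τ_ℂ(log 5/log 2) > 1/5` (Kernel XXII's tower limit for the pair `(2,5)`). [del: Kernel XXII] -/
theorem frontier_log_five_gt :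
    1 / 5 < sSup {t : ℝ | omegaRect ℂ 1 t (Real.log 5 / Real.log 2) ≤ 1 + Real.log 5 / Real.log 2} := by
  obtain ⟨t', h1, -, h3⟩ := schoenhageTowerLimit_two_five ℂ
  have hr0 : 0 ≤ Real.log 5 / Real.log 2 :=
    div_nonneg (Real.log_nonneg (by norm_num)) (Real.log_nonneg (by norm_num))
  exact h1.trans_le ((tight_iff_le_frontier hr0 t').1 h3.le)

/-! ## §4 The summit in this currency -/

/-- Under `ω = 2` the frontier is `≡ 1` on `[1, ∞)`: `ω(1,1,r) ≤ ω(1,1,1) + (r − 1) = 1 + r`.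
[folklore] -/
theorem frontier_eq_one_of_matrixMultiplication (h : _root_.MatrixMultiplication) {r : ℝ}
    (hr : 1 ≤ r) : sSup {t : ℝ | omegaRect ℂ 1 t r ≤ 1 + r} = 1 := by
  have hω : omega ℂ = 2 := _root_.MatrixMultiplication_iff.1 h
  have htight : omegaRect ℂ 1 1 r ≤ 1 + r := by
    have h1 := omegaRect_le_add₃ ℂ (a := 1) (b := 1) hr
    rw [omegaRect_one_one_one, hω] at h1
    linarith
  exact le_antisymm (frontier_le_one (by linarith)) ((tight_iff_le_frontier (by linarith) 1).1 htight)

/-- **`ω = 2 ↔ τ_ℂ(1) = 1`.** (`τ_ℂ(1) = 1` means `(1,1,1)` is tight, `ω(1,1,1) = ω ≤ 2`.)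
[folklore] -/
theorem matrixMultiplication_iff_frontier_one :
    _root_.MatrixMultiplication ↔ sSup {t : ℝ | omegaRect ℂ 1 t 1 ≤ 1 + 1} = 1 := by
  refine ⟨fun h => frontier_eq_one_of_matrixMultiplication h le_rfl, fun h => ?_⟩
  have htight : omegaRect ℂ 1 1 1 ≤ 1 + 1 := (tight_iff_le_frontier zero_le_one 1).2 h.ge
  rw [omegaRect_one_one_one] at htight
  have hge : (1 : ℝ) + 1 ≤ omega ℂ := by
    have := add_le_omegaRect₁₃ ℂ 1 1 1
    rwa [omegaRect_one_one_one] at this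
  exact _root_.MatrixMultiplication_iff.2 (by linarith)

/-- **`ω = 2 ↔ τ_ℂ ≡ 1 on [1, ∞)`**; piece 1 (`Δ → 0`, i.e. `τ_ℂ(r) = 1 − o(1/log r)`) is its
asymptotic shadow. [folklore] -/
theorem matrixMultiplication_iff_frontier_eq_one :
    _root_.MatrixMultiplication ↔
      ∀ r : ℝ, 1 ≤ r → sSup {t : ℝ | omegaRect ℂ 1 t r ≤ 1 + r} = 1 :=
  ⟨fun h _ hr => frontier_eq_one_of_matrixMultiplication h hr,
    fun h => matrixMultiplication_iff_frontier_one.2 (h 1 le_rfl)⟩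

/-- Under `ω = 2` the defect vanishes identically on `[1,∞)`. [folklore] -/
theorem frontierDefect_eq_zero_of_matrixMultiplication (h : _root_.MatrixMultiplication) {r : ℝ}
    (hr : 1 ≤ r) : (1 - sSup {t : ℝ | omegaRect ℂ 1 t r ≤ 1 + r}) * Real.log r = 0 := by
  rw [frontier_eq_one_of_matrixMultiplication h hr, sub_self, zero_mul]

end

end Summit.MatrixMultiplication.MatrixMultiplication.Theorems.SaturationLadderFrontierDefect
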